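import Summits.Ventures.PercRepro.Night2T3C6Q5M0B
import Summits.Ventures.PercRepro.Night2T3C7Q5M0Z
import Summits.Ventures.PercRepro.Night2T3C8Q5M0Z
import Summits.Ventures.PercRepro.Night2T3C9Q5M0Z
import Summits.Ventures.PercRepro.Night2T3C10Q5M0Z
import Summits.Ventures.PercRepro.Night2T3C11Q5M0Z
import Summits.Ventures.PercRepro.Night2T3C12Q5M0Z
import Summits.Ventures.PercRepro.Night2T3C13Q5M0Z
import Summits.Ventures.PercRepro.Night2T3C14Q5M0Z
import Summits.Ventures.PercRepro.Night2T3C15Q5M0Z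
import Summits.Ventures.PercRepro.Night2T3C16Q5M0Z

/-!
# PercRepro — THEOREM R5″: the type-`3` balance for `q = 5` on every COLOOP-FREE set of at most `21` points
(night-2 gen 4 — the lean cut of THEOREM R5′ for the `(7, 5)` composition of record: `f(5) ≤ 21` on the core and the
coloop-free flats are all the composition needs, so only the `(5, 0)` certificates at coranks `6 … 16` are imported)
Coranks `≤ 3`: `Jq_three_nonneg_of_card_le_add_three` (Night2T3Corank); `4`, `5`: Night2T3Corank4 / Corank5 (THEOREM C);
`6 … 16`: the `(5, 0)` certificates `Jq_three_nonneg_c{d}_q5_m0` (gen 3, README items 5, 8, 9, 12, 14, 16–20).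
-/
namespace PercRepro.Star

open Finset ThmH SixFour GenQ

variable {α : Type*} [DecidableEq α] {M : Matroid α} [M.Finite]

/-- **THEOREM R5″**: `0 ≤ J_3(G)` for every coloop-free rank-`5` set `G` with `|G| ≤ 21` of a simple matroid. -/
theorem Jq_three_nonneg_q5_of_card_le_twentyone_free (hs : Simple M) {G : Finset α} (hG : G ⊆ gr M)
    (hrG : M.eRk (G : Set α) = ((5 : ℕ) : ℕ∞)) (hcard : G.card ≤ 21) (hm : mTr M G = 0) :
    0 ≤ Jq M G 5 3 := by
  rcases Nat.lt_or_ge G.card 9 with h | h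
  · exact Jq_three_nonneg_of_card_le_add_three hs hG hrG (by norm_num) (by omega)
  obtain h9 | h10 | h11 | h12 | h13 | h14 | h15 | h16 | h17 | h18 | h19 | h20 | h21 : G.card = 9 ∨ G.card = 10 ∨ G.card = 11 ∨ G.card = 12 ∨ G.card = 13 ∨ G.card = 14 ∨ G.card = 15 ∨ G.card = 16 ∨ G.card = 17 ∨ G.card = 18 ∨ G.card = 19 ∨ G.card = 20 ∨ G.card = 21 := by omega
  · exact Jq_three_nonneg_of_card_eq_add_four hs hG hrG (by norm_num) h9
  · exact Jq_three_nonneg_of_card_eq_add_five hs hG hrG (by norm_num) h10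
  · exact Jq_three_nonneg_c6_q5_m0 hs hG hrG h11 hm
  · exact Jq_three_nonneg_c7_q5_m0 hs hG hrG h12 hm
  · exact Jq_three_nonneg_c8_q5_m0 hs hG hrG h13 hm
  · exact Jq_three_nonneg_c9_q5_m0 hs hG hrG h14 hm
  · exact Jq_three_nonneg_c10_q5_m0 hs hG hrG h15 hm
  · exact Jq_three_nonneg_c11_q5_m0 hs hG hrG h16 hm
  · exact Jq_three_nonneg_c12_q5_m0 hs hG hrG h17 hm
  · exact Jq_three_nonneg_c13_q5_m0 hs hG hrG h18 hm
  · exact Jq_three_nonneg_c14_q5_m0 hs hG hrG h19 hm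
  · exact Jq_three_nonneg_c15_q5_m0 hs hG hrG h20 hm
  · exact Jq_three_nonneg_c16_q5_m0 hs hG hrG h21 hm

end PercRepro.Star
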